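import Mathlib
import Summits.Ventures.PercRepro2.HCov
import Summits.Ventures.PercRepro2.A3RootEdge
import Summits.Ventures.PercRepro2.A3RootEdgeMain
import Summits.Ventures.PercRepro2.A3RootEdgeAll
import Summits.Ventures.PercRepro2.EdgeCubic
import Summits.Ventures.PercRepro2.EdgeCubicAll
import Summits.Ventures.PercRepro2.RootEdgeBern
import Summits.Ventures.PercRepro2.RootEdgeBernSwap
import Summits.Ventures.PercRepro2.CPolarA3
import Summits.Ventures.PercRepro2.CPolarA3Marks
import Summits.Ventures.PercRepro2.PendantClusterPins
import Summits.Ventures.PercRepro2.PendantClusterBern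
import Summits.Ventures.PercRepro2.CPolarA3Exists
import Summits.Ventures.PercRepro2.ClusterRootPins

/-!
# Row 2′CPOLAR at a CLUSTER-ROOT EDGE — the root edges of the contracted `a₃` are free in the
induction (blind cell PercRepro2, p5 g15; `proofs/P5-OEDGE.md` §18)

For `e = {a₁, z}` with `z` in the pinned-open reach of `a₃` (a root edge after contraction), the
Bernstein identities of RootEdgeBern.lean hold verbatim with the almost-sure collapses of
ClusterRootPins.lean (**`B2_eq_cluster_root`**, **`B1_eq_cluster_root`**), and the generic pieces
`g1_nonneg`, `dfc_nonneg`, `dgc_nonneg` of A3RootEdge — stated for the edge `{a₁, z}` — give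
**`B2_nonneg_cluster_root`** (unconditional) and **`B1_nonneg_cluster_root`** (given (HCOV) at
`p[e↦0]`); the `a₂` side by the root swap (`B1_swap` / `B2_swap` / `HCov_swap`):
**`B1_nonneg_of_isClusterRootEdge`**, **`B2_nonneg_of_isClusterRootEdge`**. Hence `GoodEdge'`
(a cluster-root edge, a pendant-PA edge, or `0 ≤ B1 ∧ 0 ≤ B2`), **`HCov_of_bern_a3_exists'`** and
**`HCov_all_of_cpolarA3ExistsCR_all : CPolarA3ExistsCR_all R → HCov_all R`** — the crux needs one
good `a₃`-edge per instance, where now every root edge of the CONTRACTED `a₃` is good.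
-/

namespace Summit.Ventures.PercRepro2

open UnionCluster CovForm CovForm.CPolarA3 CovForm.RootEdge PendantCluster CPolarA3Exists

namespace ClusterRoot

open CCT EdgeLine

section Bern

variable {V : Type*} {E : Type*} [Fintype V] [DecidableEq V] [Fintype E] [DecidableEq E]
  {R : Type*} [Field R] [LinearOrder R] [IsStrictOrderedRing R]

variable {ends : E → Sym2 V} {e : E} {a₁ a₃ z : V}

omit [Fintype V] [DecidableEq V] in
/-- **`B2` at a cluster-root edge is `D₀ · g₁`** (the almost-sure twin of `RootEdge.B2_eq_root`). -/
theorem B2_eq_cluster_root (p : E → R) (hends : ends e = s(a₁, z)) (hz : z ∈ pinnedReach p ends a₃) (o a₂ b : V) :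
    B2 p ends o a₁ a₂ a₃ b e =
      prob (Function.update p e 0) (PDEvent ends a₁ a₂ a₃) *
        (-2 * (prob (Function.update p e 1) (avoidAll ends a₂ {a₁}) *
          (prob (Function.update p e 1) (avoidAll ends a₂ {a₁} ∩ (connEvent ends a₂ o ∩ connEvent ends a₁ b)) -
            prob (Function.update p e 1) (avoidAll ends a₂ {a₁} ∩ (connEvent ends a₂ o ∩ connEvent ends a₂ b))) -
        (prob (Function.update p e 1) (avoidAll ends a₂ {a₁} ∩ connEvent ends a₁ b) -
            prob (Function.update p e 1) (avoidAll ends a₂ {a₁} ∩ connEvent ends a₂ b)) *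
          prob (Function.update p e 1) (avoidAll ends a₂ {a₁} ∩ connEvent ends a₂ o))) := by
  unfold B2 B2Poly polar2 EQbo EQb3 EQb3o EQo EQ3 EQ3o PDb PDbo Do
  rw [gap_eq_Q (Function.update p e 1), gap_eq_Q (Function.update p e 0)]
  simp only [prob_one_PD_inter_ae p a₂ hends hz, prob_one_T_inter_ae p a₂ hends hz,
    prob_one_T'_inter_ae p a₂ hends hz, prob_one_PD_ae p a₂ hends hz, prob_one_T_ae p a₂ hends hz,
    prob_one_T'_ae p a₂ hends hz]
  ring

/-- **`0 ≤ B2` at a cluster-root edge**, unconditionally. -/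
theorem B2_nonneg_cluster_root (p : E → R) (hp : IsProbVec p) (hends : ends e = s(a₁, z)) (hz : z ∈ pinnedReach p ends a₃) (o a₂ b : V) :
    0 ≤ B2 p ends o a₁ a₂ a₃ b e := by
  rw [B2_eq_cluster_root p hends hz o a₂ b]
  have hp₀ : IsProbVec (Function.update p e 0) := hp.update e le_rfl zero_le_one
  have hp₁ : IsProbVec (Function.update p e 1) := hp.update e zero_le_one le_rfl
  exact mul_nonneg (prob_nonneg hp₀ _) (g1_nonneg (Function.update p e 1) hp₁ ends o a₁ a₂ b)

omit [Fintype V] [DecidableEq V] in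
/-- **`B1` at a cluster-root edge**: `Q₀·Q₁·B1 = Q₁²·Gc p₀ + D₀·Q₀²·g₁ + df·dg`. -/
theorem B1_eq_cluster_root (p : E → R) (hends : ends e = s(a₁, z)) (hz : z ∈ pinnedReach p ends a₃) (o a₂ b : V) :
    prob (Function.update p e 0) (avoidAll ends a₂ {a₁}) *
        prob (Function.update p e 1) (avoidAll ends a₂ {a₁}) * B1 p ends o a₁ a₂ a₃ b e =
      prob (Function.update p e 1) (avoidAll ends a₂ {a₁}) ^ 2 *
          Gc (Function.update p e 0) ends o a₁ a₂ a₃ b +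
        prob (Function.update p e 0) (PDEvent ends a₁ a₂ a₃) *
          prob (Function.update p e 0) (avoidAll ends a₂ {a₁}) ^ 2 *
          (-2 * (prob (Function.update p e 1) (avoidAll ends a₂ {a₁}) *
            (prob (Function.update p e 1)
                (avoidAll ends a₂ {a₁} ∩ (connEvent ends a₂ o ∩ connEvent ends a₁ b)) -
              prob (Function.update p e 1)
                (avoidAll ends a₂ {a₁} ∩ (connEvent ends a₂ o ∩ connEvent ends a₂ b))) -
          (prob (Function.update p e 1) (avoidAll ends a₂ {a₁} ∩ connEvent ends a₁ b) -
              prob (Function.update p e 1) (avoidAll ends a₂ {a₁} ∩ connEvent ends a₂ b)) *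
            prob (Function.update p e 1) (avoidAll ends a₂ {a₁} ∩ connEvent ends a₂ o))) +
        (prob (Function.update p e 0) (avoidAll ends a₂ {a₁}) *
            (prob (Function.update p e 1) (avoidAll ends a₂ {a₁} ∩ connEvent ends a₁ b) -
              prob (Function.update p e 1) (avoidAll ends a₂ {a₁} ∩ connEvent ends a₂ b)) -
          prob (Function.update p e 1) (avoidAll ends a₂ {a₁}) *
            (prob (Function.update p e 0) (avoidAll ends a₂ {a₁} ∩ connEvent ends a₁ b) -
              prob (Function.update p e 0) (avoidAll ends a₂ {a₁} ∩ connEvent ends a₂ b))) *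
        (Do (Function.update p e 0) ends o a₁ a₂ a₃ *
              prob (Function.update p e 0) (avoidAll ends a₂ {a₁}) *
              prob (Function.update p e 1) (avoidAll ends a₂ {a₁}) -
            2 * prob (Function.update p e 1) (avoidAll ends a₂ {a₁} ∩ connEvent ends a₂ o) *
              prob (Function.update p e 0) (PDEvent ends a₁ a₂ a₃) *
              prob (Function.update p e 0) (avoidAll ends a₂ {a₁}) -
            DEF (Function.update p e 0) ends o a₁ a₂ a₃ *
              prob (Function.update p e 1) (avoidAll ends a₂ {a₁})) := by
  unfold B1 B1Poly polar1 Gc DEF EQbo EQb3 EQb3o EQo EQ3 EQ3o PDb PDbo Do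
  rw [gap_eq_Q (Function.update p e 1), gap_eq_Q (Function.update p e 0)]
  simp only [prob_one_PD_inter_ae p a₂ hends hz, prob_one_T_inter_ae p a₂ hends hz,
    prob_one_T'_inter_ae p a₂ hends hz, prob_one_PD_ae p a₂ hends hz, prob_one_T_ae p a₂ hends hz,
    prob_one_T'_ae p a₂ hends hz]
  ring

omit [Fintype V] [DecidableEq V] in
/-- When `Q₀ = 0` or `Q₁ = 0` every term of `B1` vanishes at a cluster-root edge. -/
theorem B1_eq_zero_of_Q_eq_zero_cluster (p : E → R) (hp : IsProbVec p) (hends : ends e = s(a₁, z)) (hz : z ∈ pinnedReach p ends a₃)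
    (o a₂ b : V)
    (hQ : prob (Function.update p e 0) (avoidAll ends a₂ {a₁}) = 0 ∨
      prob (Function.update p e 1) (avoidAll ends a₂ {a₁}) = 0) :
    B1 p ends o a₁ a₂ a₃ b e = 0 := by
  have hp₀ : IsProbVec (Function.update p e 0) := hp.update e le_rfl zero_le_one
  have hp₁ : IsProbVec (Function.update p e 1) := hp.update e zero_le_one le_rfl
  -- every mass of a sub-event of `Q` at `p_k` is squeezed to `0` when `Q` is null there
  have sub0 : ∀ X : Set (Config E), prob (Function.update p e 0) (avoidAll ends a₂ {a₁}) = 0 →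
      prob (Function.update p e 0) (avoidAll ends a₂ {a₁} ∩ X) = 0 := fun X h =>
    le_antisymm (le_trans (prob_mono hp₀ Set.inter_subset_left) h.le) (prob_nonneg hp₀ _)
  have sub1 : ∀ X : Set (Config E), prob (Function.update p e 1) (avoidAll ends a₂ {a₁}) = 0 →
      prob (Function.update p e 1) (avoidAll ends a₂ {a₁} ∩ X) = 0 := fun X h =>
    le_antisymm (le_trans (prob_mono hp₁ Set.inter_subset_left) h.le) (prob_nonneg hp₁ _)
  have PD0 : ∀ X : Set (Config E), prob (Function.update p e 0) (avoidAll ends a₂ {a₁}) = 0 →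
      prob (Function.update p e 0) (PDEvent ends a₁ a₂ a₃ ∩ X) = 0 := fun X h => by
    refine le_antisymm (le_trans (prob_mono hp₀ ?_) h.le) (prob_nonneg hp₀ _)
    intro ω hω
    simp only [Set.mem_inter_iff, PDEvent, Set.mem_compl_iff, mem_connEvent] at hω
    simp only [mem_avoidAll, Finset.mem_singleton, forall_eq]
    exact fun hc => hω.1.1 (conn_symm hc)
  have T0 : ∀ X : Set (Config E), prob (Function.update p e 0) (avoidAll ends a₂ {a₁}) = 0 →
      prob (Function.update p e 0) (TEvent ends a₁ a₂ a₃ ∩ X) = 0 := fun X h => by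
    refine le_antisymm (le_trans (prob_mono hp₀ ?_) h.le) (prob_nonneg hp₀ _)
    intro ω hω
    simp only [Set.mem_inter_iff, TEvent, Set.mem_compl_iff, mem_connEvent] at hω
    simp only [mem_avoidAll, Finset.mem_singleton, forall_eq]
    exact hω.1.1
  have T'0 : ∀ X : Set (Config E), prob (Function.update p e 0) (avoidAll ends a₂ {a₁}) = 0 →
      prob (Function.update p e 0) (TEvent ends a₂ a₁ a₃ ∩ X) = 0 := fun X h => by
    refine le_antisymm (le_trans (prob_mono hp₀ ?_) h.le) (prob_nonneg hp₀ _)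
    intro ω hω
    simp only [Set.mem_inter_iff, TEvent, Set.mem_compl_iff, mem_connEvent] at hω
    simp only [mem_avoidAll, Finset.mem_singleton, forall_eq]
    exact fun hc => hω.1.1 (conn_symm hc)
  unfold B1 B1Poly polar1 EQbo EQb3 EQb3o EQo EQ3 EQ3o PDb PDbo Do
  rw [gap_eq_Q (Function.update p e 1), gap_eq_Q (Function.update p e 0)]
  simp only [prob_one_PD_inter_ae p a₂ hends hz, prob_one_T_inter_ae p a₂ hends hz,
    prob_one_T'_inter_ae p a₂ hends hz, prob_one_PD_ae p a₂ hends hz, prob_one_T_ae p a₂ hends hz,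
    prob_one_T'_ae p a₂ hends hz]
  rcases hQ with h | h
  · have hPD : prob (Function.update p e 0) (PDEvent ends a₁ a₂ a₃) = 0 := by
      simpa only [Set.inter_univ] using PD0 Set.univ h
    simp only [sub0 _ h, PD0 _ h, T0 _ h, T'0 _ h, hPD, h]
    ring
  · simp only [sub1 _ h, h]
    ring

/-- **`0 ≤ B1` at a cluster-root edge, given (HCOV) at `p[e↦0]`**: the generic pieces `dfc_nonneg` /
`dgc_nonneg` of A3RootEdge for the edge `{a₁, z}`, with `z`'s worlds rewritten into `a₃`'s at `p[e↦0]`. -/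
theorem B1_nonneg_cluster_root (p : E → R) (hp : IsProbVec p) (hends : ends e = s(a₁, z))
    (hz : z ∈ pinnedReach p ends a₃) (hf1 : p e ≠ 1) (o a₂ b : V)
    (h₀ : HCov (Function.update p e 0) ends o a₁ a₂ a₃ b) : 0 ≤ B1 p ends o a₁ a₂ a₃ b e := by
  have hp₀ : IsProbVec (Function.update p e 0) := hp.update e le_rfl zero_le_one
  have hp₁ : IsProbVec (Function.update p e 1) := hp.update e zero_le_one le_rfl
  have hQ0 := prob_nonneg hp₀ (avoidAll ends a₂ {a₁})
  have hQ1 := prob_nonneg hp₁ (avoidAll ends a₂ {a₁})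
  rcases eq_or_lt_of_le hQ0 with hzero | hpos0
  · rw [B1_eq_zero_of_Q_eq_zero_cluster p hp hends hz o a₂ b (Or.inl hzero.symm)]
  rcases eq_or_lt_of_le hQ1 with hzero | hpos1
  · rw [B1_eq_zero_of_Q_eq_zero_cluster p hp hends hz o a₂ b (Or.inr hzero.symm)]
  have key := B1_eq_cluster_root p hends hz o a₂ b
  have hg := g1_nonneg (Function.update p e 1) hp₁ ends o a₁ a₂ b
  have hdf := dfc_nonneg p hp ends a₁ a₂ z b e hends
  have hdg := dgc_nonneg p hp ends o a₁ a₂ z e hends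
  rw [Do_zero_z_eq p a₂ hz hf1 o, prob_zero_PD_z p a₂ hz hf1, DEF_zero_z_eq p a₂ hz hf1 o] at hdg
  have hD := prob_nonneg hp₀ (PDEvent ends a₁ a₂ a₃)
  unfold HCov at h₀
  have hrhs : 0 ≤ prob (Function.update p e 0) (avoidAll ends a₂ {a₁}) *
      prob (Function.update p e 1) (avoidAll ends a₂ {a₁}) * B1 p ends o a₁ a₂ a₃ b e := by
    rw [key]
    refine add_nonneg (add_nonneg ?_ ?_) ?_
    · exact mul_nonneg (pow_nonneg hQ1 2) h₀
    · exact mul_nonneg (mul_nonneg hD (pow_nonneg hQ0 2)) hg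
    · exact mul_nonneg hdf hdg
  exact le_of_mul_le_mul_left (by rw [mul_zero]; exact hrhs) (mul_pos hpos0 hpos1)


/-- `e` is a ROOT EDGE OF THE CONTRACTED `a₃`: it joins the pinned-open reach of `a₃` to a root. -/
def IsClusterRootEdge (p : E → R) (ends : E → Sym2 V) (a₁ a₂ a₃ : V) (e : E) : Prop :=
  ∃ z ∈ pinnedReach p ends a₃,
    ends e = s(a₁, z) ∨ ends e = s(z, a₁) ∨ ends e = s(a₂, z) ∨ ends e = s(z, a₂)

omit [Fintype V] [DecidableEq V] [Fintype E] [DecidableEq E] [IsStrictOrderedRing R] in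
/-- A literal root edge at `a₃` is a cluster-root edge (`a₃` lies in its own reach). -/
lemma isClusterRootEdge_of_isRootEdge (p : E → R) (ends : E → Sym2 V) (a₁ a₂ a₃ : V) (e : E)
    (h : IsRootEdge ends a₁ a₂ a₃ e) : IsClusterRootEdge p ends a₁ a₂ a₃ e :=
  ⟨a₃, self_mem_pinnedReach, h⟩

/-- **`0 ≤ B2` at every cluster-root edge**, unconditionally. -/
theorem B2_nonneg_of_isClusterRootEdge (p : E → R) (hp : IsProbVec p) (ends : E → Sym2 V)
    (o a₁ a₂ a₃ b : V) (e : E) (he : IsClusterRootEdge p ends a₁ a₂ a₃ e) :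
    0 ≤ B2 p ends o a₁ a₂ a₃ b e := by
  obtain ⟨z, hz, h | h | h | h⟩ := he
  · exact B2_nonneg_cluster_root p hp h hz o a₂ b
  · exact B2_nonneg_cluster_root p hp (by rw [h, Sym2.eq_swap]) hz o a₂ b
  · rw [← B2_swap]
    exact B2_nonneg_cluster_root p hp h hz o a₁ b
  · rw [← B2_swap]
    exact B2_nonneg_cluster_root p hp (by rw [h, Sym2.eq_swap]) hz o a₁ b

/-- **`0 ≤ B1` at every cluster-root edge**, given (HCOV) at `p[e↦0]`. -/
theorem B1_nonneg_of_isClusterRootEdge (p : E → R) (hp : IsProbVec p) (ends : E → Sym2 V)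
    (o a₁ a₂ a₃ b : V) (e : E) (he : IsClusterRootEdge p ends a₁ a₂ a₃ e) (hf1 : p e ≠ 1)
    (h₀ : HCov (Function.update p e 0) ends o a₁ a₂ a₃ b) : 0 ≤ B1 p ends o a₁ a₂ a₃ b e := by
  obtain ⟨z, hz, h | h | h | h⟩ := he
  · exact B1_nonneg_cluster_root p hp h hz hf1 o a₂ b h₀
  · exact B1_nonneg_cluster_root p hp (by rw [h, Sym2.eq_swap]) hz hf1 o a₂ b h₀
  · rw [← B1_swap]
    exact B1_nonneg_cluster_root p hp h hz hf1 o a₁ b ((HCov_swap _ ends o a₁ a₂ a₃ b).2 h₀)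
  · rw [← B1_swap]
    exact B1_nonneg_cluster_root p hp (by rw [h, Sym2.eq_swap]) hz hf1 o a₁ b
      ((HCov_swap _ ends o a₁ a₂ a₃ b).2 h₀)

end Bern

section Induction

variable {V : Type*} {E : Type*} [Fintype V] [DecidableEq V] [Fintype E] [DecidableEq E]
  {R : Type*} [Field R] [LinearOrder R] [IsStrictOrderedRing R]

/-- An edge the induction can take: a cluster-root edge, a pendant-PA edge, or an edge whose two
Bernstein coefficients are nonnegative. -/
def GoodEdge' (q : E → R) (ends : E → Sym2 V) (o a₁ a₂ a₃ b : V) (e : E) : Prop :=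
  IsClusterRootEdge q ends a₁ a₂ a₃ e ∨ PendantPA q ends o a₁ a₂ a₃ e ∨
    (0 ≤ B1 q ends o a₁ a₂ a₃ b e ∧ 0 ≤ B2 q ends o a₁ a₂ a₃ b e)

omit [Fintype V] [DecidableEq V] [IsStrictOrderedRing R] in
/-- `GoodEdge` implies `GoodEdge'`. -/
lemma goodEdge'_of_goodEdge (q : E → R) (ends : E → Sym2 V) (o a₁ a₂ a₃ b : V) (e : E)
    (h : GoodEdge q ends o a₁ a₂ a₃ b e) : GoodEdge' q ends o a₁ a₂ a₃ b e := by
  rcases h with h | h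
  · exact Or.inl (isClusterRootEdge_of_isRootEdge q ends a₁ a₂ a₃ e h)
  · exact Or.inr h

/-- **(HCOV) when every mark-free admissible weight vector with a fractional edge touching the reach
of `a₃` has a good fractional edge touching the reach** (cluster-root edges included). -/
theorem HCov_of_bern_a3_exists' (ends : E → Sym2 V) (o a₁ a₂ a₃ b : V)
    (hB : ∀ q : E → R, IsProbVec q → MarkFree q ends o a₁ a₂ a₃ b →
      (∃ e ∈ fracEdges q, TouchesReach q ends a₃ e) →
      ∃ e ∈ fracEdges q, TouchesReach q ends a₃ e ∧ GoodEdge' q ends o a₁ a₂ a₃ b e)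
    (p : E → R) (hp : IsProbVec p) : HCov p ends o a₁ a₂ a₃ b := by
  generalize hn : (fracEdges p).card = n
  induction n using Nat.strong_induction_on generalizing p with
  | _ n ih =>
    by_cases hm : a₁ ∈ pinnedReach p ends a₃ ∨ a₂ ∈ pinnedReach p ends a₃ ∨
        o ∈ pinnedReach p ends a₃ ∨ b ∈ pinnedReach p ends a₃
    · exact HCov_of_mark_mem_pinnedReach hp hm
    · have hfree : MarkFree p ends o a₁ a₂ a₃ b := by
        simp only [not_or] at hm
        exact ⟨hm.1, hm.2.1, hm.2.2.1, hm.2.2.2⟩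
      by_cases h : ∃ e ∈ fracEdges p, TouchesReach p ends a₃ e
      · obtain ⟨e, he, _, hgood⟩ := hB p hp hfree h
        have hlt : ((fracEdges p).erase e).card < n := by
          rw [← hn]; exact Finset.card_erase_lt_of_mem he
        have hp₀ : IsProbVec (Function.update p e 0) := hp.update e le_rfl zero_le_one
        have hp₁ : IsProbVec (Function.update p e 1) := hp.update e zero_le_one le_rfl
        have h₀ : HCov (Function.update p e 0) ends o a₁ a₂ a₃ b :=
          ih _ hlt (Function.update p e 0) hp₀ (by rw [fracEdges_update p e 0 (Or.inl rfl)])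
        have h₁ : HCov (Function.update p e 1) ends o a₁ a₂ a₃ b :=
          ih _ hlt (Function.update p e 1) hp₁ (by rw [fracEdges_update p e 1 (Or.inr rfl)])
        have hfe : p e ≠ 0 ∧ p e ≠ 1 := by simpa [fracEdges] using he
        rcases hgood with hr | hpa | ⟨hB1, hB2⟩
        · exact HCov_of_update_zero_of_bern p hp ends o a₁ a₂ a₃ b e h₀ h₁
            (B1_nonneg_of_isClusterRootEdge p hp ends o a₁ a₂ a₃ b e hr hfe.2 h₀)
            (B2_nonneg_of_isClusterRootEdge p hp ends o a₁ a₂ a₃ b e hr)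
        · obtain ⟨hK, z, u, hends, hz, hu, hD, hcov⟩ := hpa
          exact HCov_cluster_of_cov_nonneg p hp hK hends hz hu hfe.2 hfree.1 hfree.2.1
            hfree.2.2.1 hfree.2.2.2 hD h₀ h₁ hcov
        · exact HCov_of_update_zero_of_bern p hp ends o a₁ a₂ a₃ b e h₀ h₁ hB1 hB2
      · simp only [not_exists, not_and] at h
        exact HCov_of_reach_pinned p hp ends o a₁ a₂ a₃ b h

end Induction

section Closure

variable (R : Type*) [Field R] [LinearOrder R] [IsStrictOrderedRing R]

/-- **One good `a₃`-edge per instance, cluster-root edges included.** -/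
def CPolarA3ExistsCR_all : Prop :=
  ∀ (V E : Type) [Fintype V] [DecidableEq V] [Fintype E] [DecidableEq E]
    (ends : E → Sym2 V) (p : E → R), IsProbVec p →
    ∀ o a₁ a₂ a₃ b : V, a₁ ≠ a₂ → a₁ ≠ a₃ → a₂ ≠ a₃ → o ≠ a₁ → o ≠ a₂ → o ≠ a₃ → o ≠ b →
      b ≠ a₁ → b ≠ a₂ → b ≠ a₃ → MarkFree p ends o a₁ a₂ a₃ b →
      (∃ e ∈ fracEdges p, TouchesReach p ends a₃ e) →
      ∃ e ∈ fracEdges p, TouchesReach p ends a₃ e ∧ GoodEdge' p ends o a₁ a₂ a₃ b e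

omit [IsStrictOrderedRing R] in
/-- `CPolarA3ExistsCR_all` is weaker than `CPolarA3Exists_all`. -/
theorem cpolarA3ExistsCR_all_of_cpolarA3Exists_all (h : CPolarA3Exists_all R) :
    CPolarA3ExistsCR_all R := by
  intro V E _ _ _ _ ends p hp o a₁ a₂ a₃ b h1 h2 h3 h4 h5 h6 h7 h8 h9 h10 hfree hex
  obtain ⟨e, he, ht, hg⟩ := h V E ends p hp o a₁ a₂ a₃ b h1 h2 h3 h4 h5 h6 h7 h8 h9 h10 hfree hex
  exact ⟨e, he, ht, goodEdge'_of_goodEdge p ends o a₁ a₂ a₃ b e hg⟩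

/-- **One good `a₃`-edge per instance (cluster-root edges included) implies the crux.** -/
theorem HCov_all_of_cpolarA3ExistsCR_all (h : CPolarA3ExistsCR_all R) : HCov_all R := by
  intro V E _ _ _ _ ends p hp o a₁ a₂ a₃ b h1 h2 h3 h4 h5 h6 h7 h8 h9 h10
  exact HCov_of_bern_a3_exists' ends o a₁ a₂ a₃ b
    (fun q hq hfree hex => h V E ends q hq o a₁ a₂ a₃ b h1 h2 h3 h4 h5 h6 h7 h8 h9 h10 hfree hex)
    p hp

end Closure

end ClusterRoot

end Summit.Ventures.PercRepro2
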